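import Literature.Barriers.ValiantsHypothesis.PlethysmCodeMachine
import Literature.Computability.Complexity.ListFoldChecks
import HarnessLib

/-!
# List codes `⟨n, λ⟩` for the plethysm chain: the entry conversion and the "prepend a row of width
# `n`" machine (Fischer–Ikenmeyer 2020, Lemma 4 and Lemma 1 on strings)

The chain of Karp reductions proving `FischerIkenmeyer2020_plethysmNPHard`
(`PlethysmHardness.lean`) keeps its intermediate instances `(μ, n)` — a partition and the outer
parameter — in the self-delimiting list coding of the tomography files: the list
`n :: μ.sortedParts` under `encodingComposition` (`⟨1^{k+1}, ⟨1ⁿ, ⟨1^{μ₁}, …⟩⟩⟩`), so that every machine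
reads its input with the item bricks of `HashBricks`/`DiscreteTomographyProofs` and never has to parse
the raw unary format of the barrier file (which is produced only at the very end,
`PlethysmTransposeMachine.lean`). This file supplies, by brick algebra:

* readers of a list code: `hdrT` (header nonempty), `item0F` (`1^{l₀}`), `tailF` (the code of the
  tail);
* **`convLF`** (the entry of the chain, string level of FI Lemma 4 after Lemma 5): on the code of a
  weakly decreasing composition `λ` with `3 ∣ |λ|`, the code of the list `|λ|/3 :: (λ without zeros)`
  — i.e. of `(n, μ)` with `μ` the partition `λ` —, and `badL` otherwise (`convLF_encode`);
* **`prependF`** (string level of FI Lemma 1 / Fact 2, "prepending a row of width `n`"): on the code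
  of `n :: L` with `n ≠ 0` and `L₀ ≤ n`, the code of `n :: n :: L`; the identity when `n = 0` (or the
  first item is empty); `badL` otherwise (`prependF_encode_cons`, `prependF_encode_zero_cons`).

## References

* [FischerIkenmeyer2020] §4 (Lemma 1: "we can compute partitions `π` … in polynomial time"),
  §6 (Lemma 4, proof), §3 (unary encodings).
* [AroraBarak2009] §1.3.
-/

noncomputable section

namespace Literature.Barriers.ValiantsHypothesis

open Literature.Computability.Complexity Literature.Computability.Complexity.Tomography
open _root_.Computability Polynomial Brick HashBricks CanonCode Plumb OracleCompose

namespace PlethCode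

/-! ### Readers of a list code -/

/-- The no-instance of the list-coded languages: the code of the empty list. [folklore] -/
def badL : List Bool := encodingComposition.encode ([] : List ℕ)

/-- `badL = ⟨ε, ε⟩`. [folklore] -/
theorem badL_eq : badL = boolPair [] [] := rfl

/-- **Header test** `[l ≠ []]`. [folklore] -/
def hdrT : List Bool → List Bool := notFn (isNilFn ∘ fstF)

/-- `hdrT ∈ FP`. [folklore] -/
theorem hdrT_mem_FP : hdrT ∈ FP := notFn_mem_FP (comp_mem_FP isNilFn_mem_FP fstF_mem_FP)

/-- `hdrT` is one-bit. [folklore] -/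
theorem oneBit_hdrT : OneBit hdrT := oneBit_notFn (oneBit_isNilFn.comp _)

/-- Value of `hdrT` on a code. [folklore] -/
theorem hdrT_wOf (l : List ℕ) : hdrT (wOf l) = [decide (l ≠ [])] := by
  rw [hdrT, notFn_apply (b := decide (fstF (wOf l) = []))]
  · rw [fstF_wOf]
    cases l <;> simp [ones]
  · rfl

/-- **The first item** `1^{l₀}`. [folklore] -/
def item0F : List Bool → List Bool := nthItemFn ∘ fanoutFn (fun _ => ones 0) sndF

/-- `item0F ∈ FP`. [folklore] -/
theorem item0F_mem_FP : item0F ∈ FP :=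
  comp_mem_FP nthItemFn_mem_FP (fanoutFn_mem_FP (const_mem_FP _) sndF_mem_FP)

/-- Value of `item0F` on a code. [folklore] -/
theorem item0F_wOf (l : List ℕ) : item0F (wOf l) = ones (listFn l 0) := by
  simp only [item0F, Function.comp_apply, fanoutFn_apply, sndF_boolPair, wOf, encode_eq_boolPair_body]
  exact nthItemFn_ones_body_map l 0

/-- **The code of the tail**: `⟨1^{k}, items after the first⟩`. [folklore] -/
def tailF : List Bool → List Bool := fanoutFn (dropFn ∘ fanoutFn (fun _ => [true]) fstF) (sndF ∘ sndF)

/-- `tailF ∈ FP`. [folklore] -/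
theorem tailF_mem_FP : tailF ∈ FP :=
  fanoutFn_mem_FP (comp_mem_FP dropFn_mem_FP (fanoutFn_mem_FP (const_mem_FP _) fstF_mem_FP))
    (comp_mem_FP sndF_mem_FP sndF_mem_FP)

/-- Value of `tailF` on the code of a nonempty list: the code of the tail. [folklore] -/
theorem tailF_wOf_cons (a : ℕ) (L : List ℕ) : tailF (wOf (a :: L)) = wOf L := by
  simp only [tailF, Function.comp_apply, fanoutFn_apply, dropFn_boolPair, sndF_boolPair, fstF_boolPair, wOf,
    encode_eq_boolPair_body, List.map_cons, body_cons, List.length_cons]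
  congr 1

/-! ### The entry conversion `convLF` -/

/-- The number of nonzero entries, in unary: `1^{#{j : λ_j ≠ 0}}`. [folklore] -/
def cntNZF : List Bool → List Bool := foldW 1 (oneIf (notFn (isNilFn ∘ itemW)))

/-- `cntNZF ∈ FP`. [folklore] -/
theorem cntNZF_mem_FP : cntNZF ∈ FP :=
  foldW_mem_FP (oneIf_mem_FP (notFn_mem_FP (comp_mem_FP isNilFn_mem_FP itemW_mem_FP)))

/-- The nonzero test of item `j`. [folklore] -/
theorem notNil_itemW_apply (l : List ℕ) (j : ℕ) :
    (notFn (isNilFn ∘ itemW)) (boolPair (wOf l) (ones j)) = [decide (listFn l j ≠ 0)] := by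
  rw [notFn_apply (b := decide (itemW (boolPair (wOf l) (ones j)) = []))]
  · rw [itemW_apply]
    simp [ones, List.replicate_eq_nil_iff]
  · rfl

/-- The number of nonzero entries of a composition is the length of the filtered list. [folklore] -/
theorem sum_indicator_ne_zero (l : List ℕ) :
    (∑ j ∈ Finset.range l.length, (decide (listFn l j ≠ 0)).toNat) = (l.filter (· ≠ 0)).length := by
  induction l with
  | nil => rfl
  | cons a t ih =>
    rw [List.length_cons, Finset.sum_range_succ', List.filter_cons]
    have hs : ∀ j, listFn (a :: t) (j + 1) = listFn t j := fun j => rfl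
    simp only [hs, ih]
    have h0 : listFn (a :: t) 0 = a := rfl
    rw [h0]
    by_cases ha : a = 0
    · subst ha; simp
    · simp [ha]

/-- Value of `cntNZF` on a code. [folklore] -/
theorem cntNZF_wOf (l : List ℕ) : cntNZF (wOf l) = ones (l.filter (· ≠ 0)).length := by
  rw [cntNZF, foldW_wOf l]
  · rw [show (fun j => oneIf (notFn (isNilFn ∘ itemW)) (boolPair (wOf l) (ones j))) =
        fun j => ones (decide (listFn l j ≠ 0)).toNat from funext fun j => oneIf_apply (notNil_itemW_apply l j),
      Tomography.ccat_ones, sum_indicator_ne_zero]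
  · intro j _
    rw [oneIf_apply (notNil_itemW_apply l j), List.length_replicate]
    have := Bool.toNat_le (decide (listFn l j ≠ 0))
    omega

/-- The items piece: `⟨1^{λ_j}, ε⟩` if `λ_j ≠ 0`, else `ε`. [folklore] -/
def nzPiece : List Bool → List Bool := iteFn (isNilFn ∘ itemW) (fun _ => []) (fanoutFn itemW fun _ => [])

/-- `nzPiece ∈ FP`. [folklore] -/
theorem nzPiece_mem_FP : nzPiece ∈ FP :=
  iteFn_mem_FP (comp_mem_FP isNilFn_mem_FP itemW_mem_FP) (const_mem_FP _) (fanoutFn_mem_FP itemW_mem_FP (const_mem_FP _))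

/-- Value of the items piece. [folklore] -/
theorem nzPiece_apply (l : List ℕ) (j : ℕ) :
    nzPiece (boolPair (wOf l) (ones j)) = if listFn l j = 0 then [] else boolPair (ones (listFn l j)) [] := by
  have hc : (isNilFn ∘ itemW) (boolPair (wOf l) (ones j)) = [decide (listFn l j = 0)] := by
    rw [Function.comp_apply, itemW_apply]
    change [decide (ones _ = [])] = _
    simp [ones, List.replicate_eq_nil_iff]
  rw [nzPiece, iteFn_apply hc]
  by_cases h : listFn l j = 0
  · rw [decide_eq_true h, if_pos rfl, if_pos h]
  · rw [decide_eq_false h, if_neg h]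
    simp [itemW_apply]

/-- The items part of the output code: the pieces concatenated. [folklore] -/
def itemsNZF : List Bool → List Bool := foldW 2 nzPiece

/-- `itemsNZF ∈ FP`. [folklore] -/
theorem itemsNZF_mem_FP : itemsNZF ∈ FP := foldW_mem_FP nzPiece_mem_FP

/-- Flattening the item pieces: the item pieces of the filtered list. [folklore] -/
theorem flatten_map_ite_boolPair (l : List ℕ) :
    (l.map fun a => if a = 0 then [] else boolPair (ones a) []).flatten =
      ((l.filter (· ≠ 0)).map fun a => boolPair (ones a) []).flatten := by
  induction l with
  | nil => rfl
  | cons a t ih =>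
    rw [List.map_cons, List.flatten_cons, ih, List.filter_cons]
    by_cases ha : a = 0
    · subst ha; simp
    · simp [ha]

/-- The items part of a code as a `ccat` over the entries. [folklore] -/
theorem ccat_items (L : List ℕ) :
    ccat (fun i => boolPair (ones (listFn L i)) []) L.length = (L.map fun a => boolPair (ones a) []).flatten := by
  rw [ccat_eq_flatten]
  congr 1
  conv_rhs => rw [← map_listFn_range L, List.map_map]
  rfl

/-- The items part of `encode L` is the `ccat` of the item pieces. [folklore] -/
theorem body_map_ones_eq_ccat (L : List ℕ) :
    body (L.map ones) = ccat (fun i => boolPair (ones (listFn L i)) []) L.length := by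
  have h1 := encode_eq_boolPair_body L
  have h2 := encode_eq_ccat L
  rw [h1] at h2
  simpa using congrArg sndF h2

/-- Value of `itemsNZF` on a code: the items part of `encode (λ.filter (· ≠ 0))`. [folklore] -/
theorem itemsNZF_wOf (l : List ℕ) :
    itemsNZF (wOf l) = ccat (fun i => boolPair (ones (listFn (l.filter (· ≠ 0)) i)) []) (l.filter (· ≠ 0)).length := by
  rw [itemsNZF, foldW_wOf l]
  · have hp : (fun j => nzPiece (boolPair (wOf l) (ones j))) =
        (fun a => if a = 0 then [] else boolPair (ones a) []) ∘ listFn l := funext (nzPiece_apply l)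
    rw [hp, ccat_eq_flatten, ← List.map_map, map_listFn_range, flatten_map_ite_boolPair, ccat_items]
  · intro j _
    rw [nzPiece_apply]
    have := listFn_le_sum l j
    have := sum_le_length_wOf l
    split_ifs
    · simp
    · rw [length_boolPair, List.length_replicate, List.length_nil]; omega

/-- The output assembly `⟨1^{k+1}, ⟨1^{n}, items⟩⟩`. [folklore] -/
def outLF : List Bool → List Bool :=
  fanoutFn (List.cons true ∘ cntNZF) (fanoutFn nF itemsNZF)

/-- `outLF ∈ FP`. [folklore] -/
theorem outLF_mem_FP : outLF ∈ FP :=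
  fanoutFn_mem_FP (comp_mem_FP (cons_mem_FP true) cntNZF_mem_FP) (fanoutFn_mem_FP nF_mem_FP itemsNZF_mem_FP)

/-- Value of `outLF` on a code with `3 ∣ |λ|`: the code of `|λ|/3 :: λ.filter (· ≠ 0)`. [folklore] -/
theorem outLF_wOf {l : List ℕ} (h3 : 3 ∣ l.sum) :
    outLF (wOf l) = encodingComposition.encode (l.sum / 3 :: l.filter (· ≠ 0)) := by
  rw [outLF, fanoutFn_apply, fanoutFn_apply, Function.comp_apply, cntNZF_wOf, nF_wOf h3, itemsNZF_wOf,
    encode_eq_boolPair_body, List.map_cons, body_cons, body_map_ones_eq_ccat, List.length_cons]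
  rfl

/-- **The entry conversion `convLF`**: on the code of a weakly decreasing composition `λ` with
`3 ∣ |λ|`, the list code of `(|λ|/3, λ without zeros)`; otherwise `badL`. [cite: FischerIkenmeyer2020, Lemma 4 (proof)] -/
def convLF : List Bool → List Bool := iteFn (andFn div3T antiT) outLF fun _ => badL

/-- **`convLF ∈ FP`**. [cite: AroraBarak2009, §1.3] -/
theorem convLF_mem_FP : convLF ∈ FP :=
  iteFn_mem_FP (andFn_mem_FP div3T_mem_FP antiT_mem_FP) outLF_mem_FP (const_mem_FP _)

/-- **Value of `convLF` on a composition code.** [cite: FischerIkenmeyer2020, Lemma 4 (proof)] -/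
theorem convLF_encode (l : List ℕ) :
    convLF (encodingComposition.encode l) =
      if 3 ∣ l.sum ∧ AntiL l then encodingComposition.encode (l.sum / 3 :: l.filter (· ≠ 0)) else badL := by
  change convLF (wOf l) = _
  rw [convLF, iteFn_apply (andFn_apply (div3T_wOf l) (antiT_wOf l))]
  by_cases h3 : 3 ∣ l.sum
  · by_cases ha : AntiL l
    · rw [decide_eq_true h3, decide_eq_true ha, Bool.true_and, if_pos rfl, if_pos ⟨h3, ha⟩, outLF_wOf h3]
    · rw [decide_eq_false ha, Bool.and_false, if_neg (by decide), if_neg (fun h => ha h.2)]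
  · rw [decide_eq_false h3, Bool.false_and, if_neg (by decide), if_neg (fun h => h3 h.1)]

/-! ### The prepend machine -/

/-- The side condition `[¬ (n < L₀)]` (`L₀ ≤ n`, vacuous for an empty tail). [folklore] -/
def condT : List Bool → List Bool := notFn (ltLenF ∘ fanoutFn item0F (item0F ∘ tailF))

/-- `condT ∈ FP`. [folklore] -/
theorem condT_mem_FP : condT ∈ FP :=
  notFn_mem_FP (comp_mem_FP ltLenF_mem_FP (fanoutFn_mem_FP item0F_mem_FP (comp_mem_FP item0F_mem_FP tailF_mem_FP)))

/-- `condT` is one-bit. [folklore] -/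
theorem oneBit_condT : OneBit condT := oneBit_notFn (oneBit_ltLenF.comp _)

/-- Value of `condT` on the code of `n :: L`. [folklore] -/
theorem condT_wOf_cons (n : ℕ) (L : List ℕ) : condT (wOf (n :: L)) = [decide (listFn L 0 ≤ n)] := by
  rw [condT, notFn_apply (b := decide (n < listFn L 0))]
  · have : (¬ (n < listFn L 0)) ↔ listFn L 0 ≤ n := not_lt
    rw [show (!decide (n < listFn L 0)) = decide (¬ (n < listFn L 0)) from decide_not.symm]
    simp only [this]
  · rw [Function.comp_apply, fanoutFn_apply, Function.comp_apply, tailF_wOf_cons, item0F_wOf, item0F_wOf,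
      ltLenF_boolPair, List.length_replicate, List.length_replicate]
    rfl

/-- The output `⟨1 · header, ⟨item₀, items⟩⟩` = the code of `n :: n :: L`. [folklore] -/
def mainPF : List Bool → List Bool := fanoutFn (List.cons true ∘ fstF) (fanoutFn item0F sndF)

/-- `mainPF ∈ FP`. [folklore] -/
theorem mainPF_mem_FP : mainPF ∈ FP :=
  fanoutFn_mem_FP (comp_mem_FP (cons_mem_FP true) fstF_mem_FP) (fanoutFn_mem_FP item0F_mem_FP sndF_mem_FP)

/-- Value of `mainPF` on the code of `n :: L`: the code of `n :: n :: L`. [folklore] -/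
theorem mainPF_wOf_cons (n : ℕ) (L : List ℕ) : mainPF (wOf (n :: L)) = wOf (n :: n :: L) := by
  rw [mainPF, fanoutFn_apply, fanoutFn_apply, Function.comp_apply, item0F_wOf, fstF_wOf]
  simp only [wOf, encode_eq_boolPair_body, sndF_boolPair, List.map_cons, body_cons, List.length_cons]
  rfl

/-- **The prepend machine**: identity if the first item is empty (`n = 0`, or no items); otherwise, on
a canonical code of `n :: L` with `L₀ ≤ n`, the code of `n :: n :: L`; `badL` else.
[cite: FischerIkenmeyer2020, §4 (Lemma 1: "construct a partition πᵀ by prepending a row of width n")] -/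
def prependF : List Bool → List Bool :=
  iteFn (isNilFn ∘ item0F) id (iteFn (andFn isCanonFn condT) mainPF fun _ => badL)

/-- **`prependF ∈ FP`**. [cite: AroraBarak2009, §1.3] -/
theorem prependF_mem_FP : prependF ∈ FP :=
  iteFn_mem_FP (comp_mem_FP isNilFn_mem_FP item0F_mem_FP) id_mem_FP
    (iteFn_mem_FP (andFn_mem_FP isCanonFn_mem_FP condT_mem_FP) mainPF_mem_FP (const_mem_FP _))

/-- `prependF` is the identity on strings whose first item is empty. [folklore] -/
theorem prependF_of_item0F_nil {w : List Bool} (h : item0F w = []) : prependF w = w := by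
  rw [prependF, iteFn_apply (b := true)]
  · rfl
  · change [decide (item0F w = [])] = _
    rw [h]; rfl

/-- `prependF` on the code of `0 :: L`: the identity. [folklore] -/
theorem prependF_encode_zero_cons (L : List ℕ) :
    prependF (encodingComposition.encode (0 :: L)) = encodingComposition.encode (0 :: L) :=
  prependF_of_item0F_nil (by change item0F (wOf (0 :: L)) = []; rw [item0F_wOf]; rfl)

/-- `prependF` on the code of the empty list: the identity. [folklore] -/
theorem prependF_encode_nil :
    prependF (encodingComposition.encode ([] : List ℕ)) = encodingComposition.encode ([] : List ℕ) :=
  prependF_of_item0F_nil (by change item0F (wOf []) = []; rw [item0F_wOf]; rfl)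

/-- **`prependF` on the code of `n :: L` with `n ≠ 0`**: the code of `n :: n :: L` if `L₀ ≤ n`, else
`badL`. [cite: FischerIkenmeyer2020, §4 (Lemma 1)] -/
theorem prependF_encode_cons {n : ℕ} (hn : n ≠ 0) (L : List ℕ) :
    prependF (encodingComposition.encode (n :: L)) =
      if listFn L 0 ≤ n then encodingComposition.encode (n :: n :: L) else badL := by
  change prependF (wOf (n :: L)) = _
  have h0 : (isNilFn ∘ item0F) (wOf (n :: L)) = [false] := by
    rw [Function.comp_apply, item0F_wOf]
    change [decide (ones _ = [])] = _
    have : listFn (n :: L) 0 = n := rfl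
    simp [this, ones, List.replicate_eq_nil_iff, hn]
  have hc : isCanonFn (wOf (n :: L)) = [true] := by
    rw [isCanonFn_apply, wOf, decComp_encode]; simp
  rw [prependF, iteFn_apply h0]
  simp only [Bool.false_eq_true, ↓reduceIte]
  rw [iteFn_apply (andFn_apply hc (condT_wOf_cons n L)), Bool.true_and]
  by_cases h : listFn L 0 ≤ n
  · rw [decide_eq_true h, if_pos rfl, if_pos h, mainPF_wOf_cons]; rfl
  · rw [decide_eq_false h, if_neg (by decide), if_neg h]

/-- `prependF` on a non-code whose first item is nonempty: `badL`. [folklore] -/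
theorem prependF_of_not_canon {w : List Bool} (hw : encodingComposition.encode (decComp w) ≠ w)
    (h0 : item0F w ≠ []) : prependF w = badL := by
  have h0' : (isNilFn ∘ item0F) w = [false] := by
    rw [Function.comp_apply]
    change [decide (item0F w = [])] = _
    simp [h0]
  have hc : isCanonFn w = [false] := by rw [isCanonFn_apply]; simp [hw]
  obtain ⟨b, hb⟩ := oneBit_condT w
  rw [prependF, iteFn_apply h0']
  simp only [Bool.false_eq_true, ↓reduceIte]
  rw [iteFn_apply (andFn_apply hc hb), Bool.false_and]
  simp

end PlethCode

end Literature.Barriers.ValiantsHypothesis
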